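import Summits.BirchSwinnertonDyer.BirchSwinnertonDyer.Theorems.TeichmullerTwistDescentCellsOfKatoIhara
import Summits.BirchSwinnertonDyer.BirchSwinnertonDyer.Theorems.EdixhovenFibreFiveSevenNonEisensteinWitness
import HarnessLib

/-!
# Route `TeichmullerTwistDescent` (rev 4): the LINE-6 glue `KummerCornerOfWildOfTame`
# (stmt-BirchSwinnertonDyer-24308) — CORNER from its WILD and TAME children, pure logic — PROVED;
# and the two children WILD (24306) / TAME (24307) granted modularity, F″ and Ihara³

Cell `pub/bsd-wall` (D-0145 line route-BirchSwinnertonDyer-TeichmullerTwistDescent, OPEN rev 4 192c5a926be2), seat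
`bsd-line-ttd-p2` (prover 2/2, g2). THEOREMS ONLY (no definition, no named fact, no `sorry`). BSD is not proved by
this; no leaf is proved by this.

* `kummerCornerOfWildOfTame_proof : KummerCornerOfWildOfTame` — the glue item 24308 BY NAME, unconditionally:
  `Classical` case split on the TAME predicate «∃ m, p ∤ m, ∃ K (p·m)-cyclotomic over ℚ_[p] with two independent
  K-rational points of order p»; the WILD child covers its negation, the TAME child the predicate (the planner's
  sketch `kummerCorner_of_tame_of_wild`, verbatim in content).
* `kummerCornerWildManinUnit_of_kato_of_iharaSq`, `kummerCornerTameManinUnit_of_kato_of_iharaSq` — both children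
  GRANTED {`exists_isNewformOf`, F″, Ihara³} (their wild/tame predicates are idle: `not_dvd_c_of_kato_of_iharaSq_of_witness` with the witness
  `NonEisensteinWitness.lTwistWitness` (edix-p5) gives `p ∤ c(D)` at EVERY lattice-optimal datum of every curve additive at `p ≥ 5` with `E[p]` irreducible);
  `…_of_pubBundles_of_iharaSq` — the same from the REGISTERED bundles 23789 + 20137 plus Ihara³.
CONDITIONAL except the glue. [cite: Kato2004Asterisque, (8.1.3) (p. 180), Thm. 9.7 (p. 189)]
[cite: DiamondRibet1997, §4.4 Lemma 4.6] [cite: KostersPannekoek2017, Thm. 1 and Cor. 2]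
-/

set_option autoImplicit false
-- single-conjunct summit: `Summit.BirchSwinnertonDyer.BirchSwinnertonDyer.…` repeats the name by design
set_option linter.dupNamespace false

noncomputable section

open scoped Classical

open WeierstrassCurve IsDedekindDomain Rat.HeightOneSpectrum NumberField
  Literature.NumberTheory.EllipticCurves Literature.NumberTheory.EllipticCurves.ModularForms
  Literature.NumberTheory.EllipticCurves.Rank1Residual Literature.NumberTheory.DiophantineGeometry
  Summit.BirchSwinnertonDyer.Rank1Residual Summit.BirchSwinnertonDyer.Rank1Residual.Additive
  Summit.BirchSwinnertonDyer.BirchSwinnertonDyer.Theses.TeichmullerTwistDescent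
  Summit.BirchSwinnertonDyer.BirchSwinnertonDyer.Theorems

namespace Summit.BirchSwinnertonDyer.BirchSwinnertonDyer.Theorems.TeichmullerTwistDescent

/-! ### The glue (stmt-BirchSwinnertonDyer-24308), unconditionally -/

/-- **The LINE-6 glue `KummerCornerOfWildOfTame` (stmt-BirchSwinnertonDyer-24308), PROVED**: CORNER follows from
its WILD child (the `p`-division field of `E/ℚ_p` NOT inside a `(p·m)`-cyclotomic extension of `ℚ_p` with two
independent rational `p`-torsion points) and its TAME child (it is), by excluded middle on the tame predicate;
every other binder is passed through verbatim. Pure logic; no number theory. [folklore] -/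
theorem kummerCornerOfWildOfTame_proof : KummerCornerOfWildOfTame := by
  intro hw ht W _ _ p _ _ D hcell hadd hirr hord htor hlat
  by_cases h : ∃ m : ℕ, ¬ p ∣ m ∧ ∃ (K : Type) (_ : Field K) (_ : Algebra ℚ K) (_ : Algebra ℚ_[p] K),
      IsCyclotomicExtension {p * m} ℚ_[p] K ∧ ∃ P Q : (W.baseChange K).toAffine.Point,
        p • P = 0 ∧ p • Q = 0 ∧ P ≠ 0 ∧ ∀ k : ℕ, Q ≠ k • P
  · exact ht W p D hcell hadd hirr hord htor h hlat
  · exact hw W p D hcell hadd hirr hord htor h hlat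

/-! ### The two children granted modularity, F″ and Ihara³ -/

/-- **WILD `KummerCornerWildManinUnit` (stmt-BirchSwinnertonDyer-24306) GRANTED modularity, F″ and Ihara³** — the
wildness predicate is idle: `not_dvd_c_of_kato_of_iharaSq_of_witness` (witness := `lTwistWitness`) gives `p ∤ c(D)` at every lattice-optimal datum.
CONDITIONAL (three cite-only facts); the item is not closed by this; BSD is not proved by this.
[cite: Kato2004Asterisque, Thm. 9.7 (p. 189)] [cite: DiamondRibet1997, §4.4 Lemma 4.6] -/
theorem kummerCornerWildManinUnit_of_kato_of_iharaSq (hnf : exists_isNewformOf)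
    (hK : kato_neron_isIntegral_twistedSymbolSum_of_additive_five_le) (hI : diamondRibet1997_iharaLemma_sq) :
    KummerCornerWildManinUnit := by
  intro W _ _ p _ _ D hcell hadd hirr _ _ _ hlat
  exact not_dvd_c_of_kato_of_iharaSq_of_witness hnf hK hI NonEisensteinWitness.lTwistWitness W p D
    (by rcases hcell with ⟨rfl, -⟩ | ⟨rfl, -⟩ <;> norm_num) hadd hirr hlat

/-- **TAME `KummerCornerTameManinUnit` (stmt-BirchSwinnertonDyer-24307) GRANTED modularity, F″ and Ihara³** — the
tame-split predicate is idle likewise. CONDITIONAL; the item is not closed by this; BSD is not proved by this.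
[cite: Kato2004Asterisque, Thm. 9.7 (p. 189)] [cite: DiamondRibet1997, §4.4 Lemma 4.6] -/
theorem kummerCornerTameManinUnit_of_kato_of_iharaSq (hnf : exists_isNewformOf)
    (hK : kato_neron_isIntegral_twistedSymbolSum_of_additive_five_le) (hI : diamondRibet1997_iharaLemma_sq) :
    KummerCornerTameManinUnit := by
  intro W _ _ p _ _ D hcell hadd hirr _ _ _ hlat
  exact not_dvd_c_of_kato_of_iharaSq_of_witness hnf hK hI NonEisensteinWitness.lTwistWitness W p D
    (by rcases hcell with ⟨rfl, -⟩ | ⟨rfl, -⟩ <;> norm_num) hadd hirr hlat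

/-- **WILD from the REGISTERED PUB bundles plus Ihara³** (twin shape «KatoNeronAndCremonaFacts →
PublishedInputsAdditiveKoly → IharaBundle → KummerCornerWildManinUnit»). CONDITIONAL; BSD is not proved by this.
[cite: DiamondRibet1997, §4.4 Lemma 4.6] -/
theorem kummerCornerWildManinUnit_of_pubBundles_of_iharaSq (hKC : KatoNeronAndCremonaFacts)
    (hP : PublishedInputsAdditiveKoly) (hI : diamondRibet1997_iharaLemma_sq) : KummerCornerWildManinUnit :=
  kummerCornerWildManinUnit_of_kato_of_iharaSq hP.2.2.2.2.2.1 hKC.1 hI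

/-- **TAME from the REGISTERED PUB bundles plus Ihara³.** CONDITIONAL; BSD is not proved by this.
[cite: DiamondRibet1997, §4.4 Lemma 4.6] -/
theorem kummerCornerTameManinUnit_of_pubBundles_of_iharaSq (hKC : KatoNeronAndCremonaFacts)
    (hP : PublishedInputsAdditiveKoly) (hI : diamondRibet1997_iharaLemma_sq) : KummerCornerTameManinUnit :=
  kummerCornerTameManinUnit_of_kato_of_iharaSq hP.2.2.2.2.2.1 hKC.1 hI

end Summit.BirchSwinnertonDyer.BirchSwinnertonDyer.Theorems.TeichmullerTwistDescent

end
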